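import Mathlib

set_option linter.dupNamespace false
-- (single-conjunct summit: the mandated namespace repeats `MatrixMultiplication`)

/-!
# Rank presentation of a finite abelian group (U2 universality stub `stub_rankPresentation`)

Support file of crux `EisensteinValCertificates.HomocyclicSTPPDesigns`
(stmt-MatrixMultiplication-10647), second hypothesis of the universality glue
`HomocyclicSTPPDesigns_of_subs` (`…UniversalityGlue.lean`).
Let `H` be a finite abelian group with `|H| > 1`, write its primary decomposition
`H ≃ Π_i ℤ/(q_i^{e_i})` (Mathlib's `AddCommGroup.equiv_directSum_zmod_of_finite`; factors with
`e_i = 0` are trivial), let `n ≥ 1` be its RANK (the largest number of nontrivial factors belonging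
to one prime) and let `p` be a prime attaining it.  Then
(i) `H ≃ (Π_{l<n} ℤ/p^{r_l}) × G'` with `r_l ≥ 1` (the `p`-factors against the rest), and
(ii) `H ≃ Π_{j<n} ℤ/m_j` with the SAME `n`: put the `k`-th nontrivial factor of each prime into
column `k < n` (trivial factors into column `0`), so that the moduli inside one column are pairwise
coprime, and apply the Chinese remainder theorem (`ZMod.prodEquivPi`) column by column,
`m_j := ∏_{col i = j} q_i^{e_i} ≥ 1`.  Pure structure-theorem bookkeeping. [folklore]
-/

namespace Summit.MatrixMultiplication.MatrixMultiplication.Theorems.HomocyclicSTPPDesigns.Universality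

/-! ## Primary decomposition indexed by `Fin N` -/

/-- Primary decomposition indexed by `Fin N`: a finite abelian group is a product
`Π_{i<N} ℤ/(q_i^{e_i})` with all `q_i` prime (exponents `e_i = 0` allowed). [folklore] -/
private theorem exists_addEquiv_pi_fin_zmod_primePow (H : Type) [AddCommGroup H] [Finite H] :
    ∃ (N : ℕ) (q e : Fin N → ℕ), (∀ i, (q i).Prime) ∧
      Nonempty (H ≃+ ((i : Fin N) → ZMod (q i ^ e i))) := by
  classical
  obtain ⟨ι, _, p, hp, e, ⟨f⟩⟩ := AddCommGroup.equiv_directSum_zmod_of_finite H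
  refine ⟨Fintype.card ι, fun k => p ((Fintype.equivFin ι).symm k),
    fun k => e ((Fintype.equivFin ι).symm k), fun k => hp _, ⟨?_⟩⟩
  exact (f.trans (DirectSum.addEquivProd _)).trans
    (RingEquiv.piCongrLeft' (fun i => ZMod (p i ^ e i)) (Fintype.equivFin ι)).toAddEquiv

/-! ## Splitting off the factors of one prime -/

/-- Splitting off the factors selected by a decidable predicate `P` on which every modulus is a
power of one fixed `p₀`: `Π_i ℤ/a_i ≃ (Π_{l<n} ℤ/p₀^{r_l}) × Π_{¬P} ℤ/a_i` for `n = #P`, the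
exponents `r_l` being a re-enumeration of the given ones. [folklore] -/
private theorem exists_addEquiv_split {N : ℕ} (a : Fin N → ℕ) (P : Fin N → Prop)
    [DecidablePred P] (p₀ : ℕ) (r' : Fin N → ℕ) (n : ℕ) (hn : Fintype.card {i // P i} = n)
    (ha : ∀ i, P i → a i = p₀ ^ r' i) :
    ∃ r : Fin n → ℕ, (∀ l, ∃ i, P i ∧ r l = r' i) ∧
      Nonempty (((i : Fin N) → ZMod (a i)) ≃+
        ((l : Fin n) → ZMod (p₀ ^ r l)) × ((i : {i // ¬P i}) → ZMod (a i.1))) := by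
  let eS : {i // P i} ≃ Fin n := (Fintype.equivFin {i // P i}).trans (finCongr hn)
  refine ⟨fun l => r' (eS.symm l).1, fun l => ⟨(eS.symm l).1, (eS.symm l).2, rfl⟩, ⟨?_⟩⟩
  exact (RingEquiv.piEquivPiSubtypeProd P (fun i => ZMod (a i))).toAddEquiv.trans
    (AddEquiv.prodCongr
      ((AddEquiv.piCongrRight fun i : {i // P i} =>
          (ZMod.ringEquivCongr (ha i.1 i.2)).toAddEquiv).trans
        (RingEquiv.piCongrLeft' (fun i : {i // P i} => ZMod (p₀ ^ r' i.1)) eS).toAddEquiv)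
      (AddEquiv.refl _))

/-! ## Column-wise Chinese remainder theorem -/

/-- Column-wise Chinese remainder theorem: if `col` assigns the indices to `n` columns so that two
distinct indices in one column carry coprime moduli, then `Π_i ℤ/a_i ≃ Π_{j<n} ℤ/m_j` with
`m_j = ∏_{col i = j} a_i`. [folklore] -/
private theorem nonempty_addEquiv_pi_zmod_columns {N n : ℕ} (a : Fin N → ℕ) (col : Fin N → Fin n)
    (hcop : ∀ i i', i ≠ i' → col i = col i' → Nat.Coprime (a i) (a i')) :
    Nonempty (((i : Fin N) → ZMod (a i)) ≃+
      ((j : Fin n) → ZMod (∏ i : {i // col i = j}, a i.1))) := by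
  have hpw : ∀ j : Fin n,
      Pairwise (Function.onFun Nat.Coprime fun i : {i // col i = j} => a i.1) :=
    fun j i i' hne => hcop i.1 i'.1 (fun h => hne (Subtype.ext h)) (i.2.trans i'.2.symm)
  let crt : ∀ j : Fin n,
      ZMod (∏ i : {i // col i = j}, a i.1) ≃+* ((i : {i // col i = j}) → ZMod (a i.1)) :=
    fun j => ZMod.prodEquivPi (fun i : {i // col i = j} => a i.1) (hpw j)
  exact ⟨{ toFun := fun x j => (crt j).symm fun i => x i.1
           invFun := fun y i => crt (col i) (y (col i)) ⟨i, rfl⟩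
           left_inv := fun x => by
             funext i
             show crt (col i) ((crt (col i)).symm fun i' => x i'.1) ⟨i, rfl⟩ = x i
             rw [RingEquiv.apply_symm_apply]
           right_inv := fun y => by
             funext j
             have h : (fun i : {i // col i = j} => crt (col i.1) (y (col i.1)) ⟨i.1, rfl⟩) =
                 crt j (y j) := by
               funext i
               obtain ⟨i, hi⟩ := i
               subst hi
               rfl
             show (crt j).symm
                 (fun i : {i // col i = j} => crt (col i.1) (y (col i.1)) ⟨i.1, rfl⟩) = y j
             rw [h, RingEquiv.symm_apply_apply]
           map_add' := fun x y => by
             funext j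
             show (crt j).symm (fun i => x i.1 + y i.1) =
                 (crt j).symm (fun i => x i.1) + (crt j).symm (fun i => y i.1)
             rw [← map_add]
             rfl }⟩

/-! ## Columns: the rank of a factor among the nontrivial factors of its prime -/

/-- The column of a factor `i` — the number of earlier factors with the same prime and a positive
exponent — is strictly increasing along the nontrivial factors of one prime. [folklore] -/
private theorem card_filter_lt_card_filter {N : ℕ} (q e : Fin N → ℕ) {i i' : Fin N} (h : i < i')
    (hq : q i = q i') (he : 0 < e i) :
    (Finset.univ.filter fun k => k < i ∧ q k = q i ∧ 0 < e k).card <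
      (Finset.univ.filter fun k => k < i' ∧ q k = q i' ∧ 0 < e k).card := by
  apply Finset.card_lt_card
  refine (Finset.ssubset_iff_of_subset ?_).2 ⟨i, ?_, ?_⟩
  · intro k hk
    simp only [Finset.mem_filter, Finset.mem_univ, true_and] at hk ⊢
    exact ⟨hk.1.trans h, hk.2.1.trans hq, hk.2.2⟩
  · simp only [Finset.mem_filter, Finset.mem_univ, true_and]
    exact ⟨h, hq, he⟩
  · simp only [Finset.mem_filter, Finset.mem_univ, true_and, lt_self_iff_false, false_and,
      not_false_eq_true]

/-- The column of a nontrivial factor is less than the multiplicity of its prime. [folklore] -/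
private theorem card_filter_lt_card_subtype {N : ℕ} (q e : Fin N → ℕ) {i : Fin N}
    (he : 0 < e i) :
    (Finset.univ.filter fun k => k < i ∧ q k = q i ∧ 0 < e k).card <
      Fintype.card {k // q k = q i ∧ 0 < e k} := by
  rw [Fintype.card_subtype]
  apply Finset.card_lt_card
  refine (Finset.ssubset_iff_of_subset ?_).2 ⟨i, ?_, ?_⟩
  · intro k hk
    simp only [Finset.mem_filter, Finset.mem_univ, true_and] at hk ⊢
    exact hk.2
  · simpa only [Finset.mem_filter, Finset.mem_univ, true_and] using he
  · simp only [Finset.mem_filter, Finset.mem_univ, true_and, lt_self_iff_false, false_and,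
      not_false_eq_true]

/-! ## The rank presentation -/

/-- **Rank presentation of a finite abelian group** (registered stub `stub_rankPresentation` of
the universality glue `HomocyclicSTPPDesigns_of_subs`): every finite abelian `H` with `|H| > 1`
is, for ONE prime `p` and its rank `n` (the maximal number of nontrivial cyclic factors of one
prime in the primary decomposition, attained at `p`), both `≃ (Π_{l<n} ℤ/p^{r_l}) × G'` with
`r_l ≥ 1` and `≃ Π_{j<n} ℤ/m_j` with the same `n` (columns of pairwise coprime prime powers,
Chinese remainder theorem column by column). [folklore] -/
theorem stub_rankPresentation : ∀ (H : Type) [AddCommGroup H] [Fintype H], 1 < Fintype.card H →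
    ∃ (p : ℕ) (_ : Fact p.Prime) (n : ℕ) (r : Fin n → ℕ) (_ : ∀ l, 1 ≤ r l) (G' : Type)
      (_ : AddCommGroup G') (_ : Fintype G') (_ : DecidableEq G')
      (_ : H ≃+ ((l : Fin n) → ZMod (p ^ r l)) × G') (m : Fin n → ℕ) (_ : ∀ j, 0 < m j),
      Nonempty (H ≃+ ((j : Fin n) → ZMod (m j))) := by
  intro H _ _ hH
  obtain ⟨N, q, e, hq, ⟨φ⟩⟩ := exists_addEquiv_pi_fin_zmod_primePow H
  -- `|H| = ∏ q_i ^ e_i`, so some exponent is positive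
  have hcard : Fintype.card H = ∏ i, q i ^ e i := by
    rw [← Nat.card_eq_fintype_card, Nat.card_congr φ.toEquiv, Nat.card_pi]
    exact Finset.prod_congr rfl fun i _ => Nat.card_zmod _
  have hex : ∃ i, 0 < e i := by
    by_contra h
    simp only [not_exists, not_lt, Nat.le_zero] at h
    rw [hcard, Finset.prod_eq_one fun i _ => by rw [h i, pow_zero]] at hH
    exact lt_irrefl _ hH
  obtain ⟨i₁, hi₁⟩ := hex
  -- the prime `q i₀` of maximal multiplicity `n` among the nontrivial factors
  obtain ⟨i₀, -, hi₀⟩ := Finset.exists_max_image Finset.univ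
    (fun i => Fintype.card {k // q k = q i ∧ 0 < e k}) ⟨i₁, Finset.mem_univ _⟩
  obtain ⟨n, hn⟩ : ∃ n, Fintype.card {k // q k = q i₀ ∧ 0 < e k} = n := ⟨_, rfl⟩
  have hle : ∀ i, Fintype.card {k // q k = q i ∧ 0 < e k} ≤ n := fun i =>
    (hi₀ i (Finset.mem_univ i)).trans_eq hn
  have h1 : 0 < Fintype.card {k // q k = q i₁ ∧ 0 < e k} :=
    Fintype.card_pos_iff.2 ⟨⟨i₁, rfl, hi₁⟩⟩
  have hn0 : 0 < n := h1.trans_le (hle i₁)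
  -- (i) the `q i₀`-part against the rest
  obtain ⟨r, hr, ⟨ψ₁⟩⟩ := exists_addEquiv_split (fun i => q i ^ e i)
    (fun k => q k = q i₀ ∧ 0 < e k) (q i₀) e n hn (fun i hi => congrArg (· ^ e i) hi.1)
  -- (ii) columns: the `k`-th nontrivial factor of each prime goes to column `k`
  -- (trivial factors to column `0`); CRT column by column
  have hrank : ∀ i, 0 < e i →
      (Finset.univ.filter fun k => k < i ∧ q k = q i ∧ 0 < e k).card < n := fun i h =>
    (card_filter_lt_card_subtype q e h).trans_le (hle i)
  let col : Fin N → Fin n := fun i =>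
    ⟨if 0 < e i then (Finset.univ.filter fun k => k < i ∧ q k = q i ∧ 0 < e k).card else 0, by
      split_ifs with h
      · exact hrank i h
      · exact hn0⟩
  have hcol : ∀ i, 0 < e i →
      (col i : ℕ) = (Finset.univ.filter fun k => k < i ∧ q k = q i ∧ 0 < e k).card := fun i h =>
    show (if 0 < e i then _ else 0) = _ from if_pos h
  have hcop : ∀ i i', i ≠ i' → col i = col i' → Nat.Coprime (q i ^ e i) (q i' ^ e i') := by
    intro i i' hne hc
    rcases Nat.eq_zero_or_pos (e i) with hi | hi
    · rw [hi, pow_zero]; exact Nat.coprime_one_left _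
    rcases Nat.eq_zero_or_pos (e i') with hi' | hi'
    · rw [hi', pow_zero]; exact Nat.coprime_one_right _
    by_cases hqq : q i = q i'
    · have hrr := congrArg Fin.val hc
      rw [hcol i hi, hcol i' hi'] at hrr
      rcases lt_trichotomy i i' with h | h | h
      · exact absurd hrr (card_filter_lt_card_filter q e h hqq hi).ne
      · exact absurd h hne
      · exact absurd hrr.symm (card_filter_lt_card_filter q e h hqq.symm hi').ne
    · exact Nat.Coprime.pow _ _ ((Nat.coprime_primes (hq i) (hq i')).2 hqq)
  obtain ⟨ψ₂⟩ := nonempty_addEquiv_pi_zmod_columns (fun i => q i ^ e i) col hcop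
  haveI : ∀ i, NeZero (q i ^ e i) := fun i => ⟨pow_ne_zero _ (hq i).ne_zero⟩
  refine ⟨q i₀, ⟨hq i₀⟩, n, r, fun l => ?_,
    ((i : {i // ¬(q i = q i₀ ∧ 0 < e i)}) → ZMod (q i.1 ^ e i.1)),
    inferInstance, inferInstance, inferInstance, φ.trans ψ₁,
    fun j => ∏ i : {i // col i = j}, q i.1 ^ e i.1,
    fun j => Finset.prod_pos fun i _ => pow_pos (hq i.1).pos _, ⟨φ.trans ψ₂⟩⟩
  obtain ⟨i, hi, hl⟩ := hr l
  rw [hl]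
  exact hi.2

end Summit.MatrixMultiplication.MatrixMultiplication.Theorems.HomocyclicSTPPDesigns.Universality
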